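/-
Copyright: public-audit package `pub-balaban` (b2b-balaban), seat pv28-g13. Released under Apache 2.0 like Mathlib.
-/
import Literature.MathematicalPhysics.QuantumFieldTheory.Balaban1983to89.T4CubeConvexExtension

/-!
# T4 — caveat (γ) of the Brascamp–Lieb window transport, first rung: the ACTION half of the convexity modulus in
# the gnomonic `SU(2)` chart, for ONE-LINK QUATERNION-AFFINE (Wilson-type) exponents — computed, not assumed

* Value = kernel certificate (calculus on `S³ ⊂ ℍ` in the gnomonic chart); NOT summit progress; NOT continuum; NOT Clay.
  0 [cite], 0 [model]: everything here is [folklore]; NO printed sentence is asserted and nothing internally minted is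
  cited (ABSOLUTE RULE).  Cell row T4-O3.E-iii-b-G7 (BL-window), lineage pv28 (g8 `T4CubeChartTransport` → g10/11
  `T4CubeChartGnomonic` → g12 `T4CubeConvexExtension` → this leaf); record `t4/T4-EST-O3Eiiib-G7.md` §2quinquies (γ):
  "Nothing here sizes `λ`, `b_H`, `L` — Bałaban-side inputs".
* WHAT IT DISCHARGES.  In `T4CubeConvexExtension.mem_respDom_of_gnoChart_local` the ACTION-side binders
  `hg₀ hg₁ : ContDiff ℝ 2 gᵢ`, `hB₀ hB₁ : HessianBoundOn gᵢ [-S',S']ⁿ μ`, `agree₀ agree₁ : gᵢ = −h(· ←ₛ φ(x))` on `[-S,S]ⁿ`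
  (and, in the primed plug, the gradient-gap binder `hgap`) are abstract: an inhabitant must be PRODUCED from the
  exponent `h`.  Here they are produced — with an EXPLICIT modulus — for the one-link fibre `s = {b}` and every exponent
  that is quaternion-affine in the link `U(b)` at the two base fields (`LinkAffine h u b κ a :
  ∀ g, h(u ←_b g) = κ + Re(su2Quat g · a)`), the algebraic shape of a sum of single letters `reTr(L·U(b)·R)` with
  cofactors free of `U(b)` (`reTr_conj_link`; e.g. the Wilson plaquette terms through `b` when `b` occurs once in each
  `U(∂p)`, caveat (PLAQ) — NO such instance is constructed here).

## The mechanism (§1–§4)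

An affine function of `ℍ ≅ ℝ⁴` restricted to the unit sphere, read in the gnomonic chart about `q₀ = su2Quat(u₀ b)`:
with `c = a·q₀`, `A = Re c` (the ALIGNED part of the datum), `B = Im c ∈ ℝ³` (the TRANSVERSE part),

  `−Re(su2Quat(u₀(b)·P(1,v)) · a) = F_{A,B}(v) := (B·v − A)/√(1 + v·v)`      (`re_su2Quat_gnoChart_mul`),

so the pulled-back action `x ↦ −h(u ←_b φ(x))` IS `−κ + F_{A, B}(v(x))` on all of `ℝⁿ` (`linkRep_eq`) — a global `C^∞`
representative, no extension step.  Its Hessian in closed form (H1, `fderiv_fderiv_gnoProfile`; `a = 1 + x·x`):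

  `D²F(x)(w,w) = [(A − B·x)(|w|² a − 3(x·w)²) − 2(B·w)(x·w) a] / a^{5/2}`,   `= A|w|²` at `x = 0`,

and the WINDOW BOUND (H2, `gnoMu_mul_le_fderiv_fderiv_gnoProfile`): for `A ≥ 0`, `|B| ≤ b`, on `x·x ≤ ρ²` with `2ρ² ≤ 1`,

  `D²F(x)(w,w) ≥ μ(A,b,ρ)|w|²`,   `μ(A,b,ρ) = A(1 − 2ρ²)/(1 + ρ²)^{5/2} − 3bρ`   (`gnoMu`; `μ(A,b,0) = A`),

(Cauchy–Schwarz three times and `1 ≤ a ≤ 1 + ρ²`; `profile_ineq` is the square-root-free real inequality), whence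
`HessianBoundOn F [-S',S']ⁿ μ(A,b,ρ)` for `n S'² ≤ ρ²` (H3); and the gradient size `|∇F(x)|² ≤ (b(1+ρ²) + |A|ρ)²` (G2),
which gives the gradient gap of two representatives `|∇(g₁ − g₀)|² ≤ (|a₁ − a₀|(1 + ρ + ρ²))²` (R4: the difference of two
affine data is the affine datum of the difference, `linkRep_sub`).

READING (informal, nothing of it is typed or cited): for the Wilson exponent `h = β Σ_p reTr U(∂p)` and a link `b`
occurring once in each `U(∂p)`, `p ∋ b`, the datum is `a = β Σ_{p ∋ b} su2Quat(R_p)·su2Quat(L_p)` (the "staples");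
at a configuration with all plaquettes through `b` equal to `1` one gets `a·q₀ = β·#{p ∋ b}`, i.e. `A = 2(d−1)β`, `B = 0`
and `μ = 2(d−1)β(1 − 2ρ²)/(1 + ρ²)^{5/2}`: near flat fields the action convexity modulus in the chart is PROPORTIONAL TO
`β = 1/g²` and degrades linearly in the transverse staple part `b` and the window radius `ρ` — the place where a
small-field condition enters (caveat (ALIGN)).

## Content

* §1 the profile `gnoProfile A B` and its calculus along lines (`contDiff_gnoProfile`, `hasDerivAt_gnoProfile_line`,
  `fderiv_gnoProfile` = the closed form of `DF(x) w`).
* §2 `gnoHess`, **`fderiv_fderiv_gnoProfile`** (H1), `fderiv_fderiv_gnoProfile_zero`.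
* §3 `gnoMu`, `gnoMu_zero`, monotonicity, `dotProduct_sq_le`, `profile_ineq`, **`gnoMu_mul_le_fderiv_fderiv_gnoProfile`**
  (H2), `hessianBoundOn_gnoProfile_ball` / `_cube` (H3), `hessianBoundOn_const_add`, `HessianBoundOn.of_le`; the gradient:
  `sq_fderiv_gnoProfile_le` (G1), `fderiv_apply_eq_coordGradient_dotProduct`, `coordGradient_gnoProfile_sq_le` (G2).
* §4 the quaternion reading: `imVec`, `norm_gnomonicQuat`, `imVec_dotProduct_self`, `re_su2Quat_gnoPoint_mul`,
  **`re_su2Quat_gnoChart_mul`**, `reTr_eq_re_su2Quat` (the cell's `reTr` on `SU(2)` is `Re ∘ su2Quat`), `reTr_conj_link`.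
* §5 `LinkAffine`, `linkCoord`, `linkVec`, `linkRep` and (R1) `linkRep_eq`, (R2) `contDiff_linkRep`,
  (R3) `hessianBoundOn_linkRep`, `linkRep_sub`, (R4) `coordGradient_linkRep_sub_sq_le`.
* §6 **`mem_respDom_of_gnoChart_linkAffine`**: `mem_respDom_of_gnoChart_local` on `s = {b}` with `hg₀ hg₁ hB₀ hB₁ agree₀
  agree₁` replaced by `LinkAffine h u₀ b κ₀ a₀`, `LinkAffine h u b κ₁ a₁` and NUMBERS: `Re(aᵢ q₀) ≥ 0`,
  `|aᵢ|² − Re(aᵢ q₀)² ≤ b₀²`, `n S'² ≤ ρ²`, `2ρ² ≤ 1`, `μ ≤ μ(Re(aᵢ q₀), b₀, ρ)`, `κ(S') + μ > 0`; and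
  **`mem_respDom_of_gnoChart_linkAffine'`** with `hgap` replaced by `|a₁ − a₀|(1 + ρ + ρ²) ≤ b_H · dev u` as well.
  Same conclusion `u ∈ respDom {b} (windowDensity {b} u₀ S) h u₀ B T dev (b_H/√(κ(S')+μ)) (L/√(κ(S')+μ))`.

## Caveats

* (PLAQ) NO instance of `LinkAffine` is constructed.  For the Wilson exponent the shape holds through `b = ⟨x, μ⟩` iff `b`
  occurs exactly once among the four letters of each `U(∂p)`, `p ∋ b` (`Setup.GaugeField.plaqHol`): this needs `p.μ ≠ p.ν`
  AND a torus side `≥ 2` in direction `ν` at scale `j` (else `⟨x + e_ν, μ⟩ = ⟨x, μ⟩` and the plaquette term is QUADRATIC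
  in the link); typing it against the cell's plaquette/bond incidence is left to a successor (cell gap G-pv28g13-1).
* (N1) ONE link: `s = {b}`.  On a multi-link fibre, plaquettes containing two links of `s` couple the blocks bilinearly;
  the pulled-back action is then not a sum of decoupled profiles and (H2) does not apply verbatim.
* (ALIGN) The numbers `Re(aᵢ q₀) ≥ 0`, `b₀`, `ρ`, `μ` are HYPOTHESES: sizing them (alignment of `u₀(b)` with its staples
  inside a small-field region, `β`-dependence) is Bałaban-side and is neither done nor quoted here.
* (RANK) `SU(2)` only (quaternion model `su2Quat`/`quatToSU2`); no gnomonic chart for `SU(N ≥ 3)` exists in the tree.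
* (INS) The insert binders `hBm hBg` and the integrability side `hhm hC hK` of the consumer are untouched.
-/

noncomputable section

open _root_.MeasureTheory Set
open Function (updateFinset)
open scoped Real Quaternion Topology

namespace Literature.MathematicalPhysics.QuantumFieldTheory.Balaban1983to89.T4GnomonicWilsonHessian

open Literature.MathematicalPhysics.QuantumLattice (quatToSU2 su2Quat gnomonicQuat gnomonicQuat_ne_zero
  norm_gnomonicQuat_pos sq_norm_gnomonicQuat)
open Literature.Probability.Distributions (coordGradient coordHessian)
open T4HaarSU2Translate (su2Quat_quatToSU2 su2Quat_mul)
open T4TiltModulus T4CubePoincare T4CubeChartTransport T4CubeChartGnomonic T4CubeConvexExtension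

variable {n : ℕ}

/-! ## §1  The gnomonic profile `F_{A,B}(x) = (B·x − A)/√(1 + x·x)` of an affine datum and its derivatives along lines -/

/-- **THE GNOMONIC PROFILE** of the affine datum `(A, B) ∈ ℝ × ℝⁿ`: `F_{A,B}(x) = (B·x − A)/√(1 + x·x)` — the restriction
of the affine function `(y₀, y) ↦ B·y − A y₀` of `ℝ × ℝⁿ` to the unit sphere, read in the gnomonic chart
`x ↦ (1, x)/|(1, x)|`. [folklore] -/
def gnoProfile (A : ℝ) (B : Fin n → ℝ) (x : Fin n → ℝ) : ℝ := (B ⬝ᵥ x - A) / Real.sqrt (1 + x ⬝ᵥ x)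

/-- `1 + x·x > 0`. [folklore] -/
theorem one_add_dotProduct_self_pos (x : Fin n → ℝ) : 0 < 1 + x ⬝ᵥ x := by
  linarith [(by simpa using dotProduct_star_self_nonneg x : (0 : ℝ) ≤ x ⬝ᵥ x)]

/-- The profile is LINEAR in the datum: `F_{A₁,B₁} − F_{A₀,B₀} = F_{A₁−A₀, B₁−B₀}`. [folklore] -/
theorem gnoProfile_sub (A₀ A₁ : ℝ) (B₀ B₁ : Fin n → ℝ) (x : Fin n → ℝ) :
    gnoProfile A₁ B₁ x - gnoProfile A₀ B₀ x = gnoProfile (A₁ - A₀) (B₁ - B₀) x := by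
  unfold gnoProfile
  rw [sub_dotProduct]
  ring

/-- At the centre: `F_{A,B}(0) = −A`. [folklore] -/
theorem gnoProfile_zero (A : ℝ) (B : Fin n → ℝ) : gnoProfile A B 0 = -A := by
  simp [gnoProfile]

/-- `x ↦ x·x` is smooth. [folklore] -/
theorem contDiff_dotProduct_self {m : WithTop ℕ∞} : ContDiff ℝ m fun x : Fin n → ℝ => x ⬝ᵥ x :=
  ContDiff.sum fun i _ => (contDiff_apply ℝ ℝ i).mul (contDiff_apply ℝ ℝ i)

/-- `x ↦ B·x` is smooth. [folklore] -/
theorem contDiff_dotProduct_left (B : Fin n → ℝ) {m : WithTop ℕ∞} : ContDiff ℝ m fun x : Fin n → ℝ => B ⬝ᵥ x :=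
  ContDiff.sum fun i _ => contDiff_const.mul (contDiff_apply ℝ ℝ i)

/-- **The profile is smooth** (`C^m` for every `m`): `1 + x·x ≥ 1` stays away from the singularity of `√`. [folklore] -/
theorem contDiff_gnoProfile (A : ℝ) (B : Fin n → ℝ) {m : WithTop ℕ∞} : ContDiff ℝ m (gnoProfile A B) := by
  unfold gnoProfile
  refine ContDiff.div ((contDiff_dotProduct_left B).sub contDiff_const)
    ((contDiff_const.add contDiff_dotProduct_self).sqrt fun x => (one_add_dotProduct_self_pos x).ne') fun x => ?_
  exact (Real.sqrt_pos.2 (one_add_dotProduct_self_pos x)).ne'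

/-- The data of the profile along the line `t ↦ x + t w`: `a = 1 + x·x`, `b = x·w`, `c = w·w`, `N₀ = B·x − A`, `N₁ = B·w`;
the line quadratic `q(t) = a + 2bt + ct² = 1 + (x+tw)·(x+tw)`. [folklore] -/
theorem lineQuad_eq (x w : Fin n → ℝ) (t : ℝ) :
    (1 + x ⬝ᵥ x) + 2 * (x ⬝ᵥ w) * t + (w ⬝ᵥ w) * t ^ 2 = 1 + (x + t • w) ⬝ᵥ (x + t • w) := by
  rw [add_dotProduct, dotProduct_add, dotProduct_add, dotProduct_smul, smul_dotProduct, smul_dotProduct,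
    dotProduct_smul, smul_eq_mul, smul_eq_mul, smul_eq_mul, smul_eq_mul, dotProduct_comm w x]
  ring

/-- The line quadratic is positive. [folklore] -/
theorem lineQuad_pos (x w : Fin n → ℝ) (t : ℝ) : 0 < (1 + x ⬝ᵥ x) + 2 * (x ⬝ᵥ w) * t + (w ⬝ᵥ w) * t ^ 2 := by
  rw [lineQuad_eq]; exact one_add_dotProduct_self_pos _

/-- **THE PROFILE ALONG A LINE**: `F(x + tw) = (N₀ + N₁ t)/√(a + 2bt + ct²)`. [folklore] -/
theorem gnoProfile_add_smul (A : ℝ) (B x w : Fin n → ℝ) (t : ℝ) :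
    gnoProfile A B (x + t • w)
      = ((B ⬝ᵥ x - A) + (B ⬝ᵥ w) * t) / Real.sqrt ((1 + x ⬝ᵥ x) + 2 * (x ⬝ᵥ w) * t + (w ⬝ᵥ w) * t ^ 2) := by
  rw [gnoProfile, lineQuad_eq, dotProduct_add, dotProduct_smul, smul_eq_mul]
  ring_nf

/-- The line quadratic has derivative `2b + 2ct`. [folklore] -/
theorem hasDerivAt_lineQuad (x w : Fin n → ℝ) (t : ℝ) :
    HasDerivAt (fun t : ℝ => (1 + x ⬝ᵥ x) + 2 * (x ⬝ᵥ w) * t + (w ⬝ᵥ w) * t ^ 2)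
      (2 * (x ⬝ᵥ w) + 2 * (w ⬝ᵥ w) * t) t := by
  have hsq : HasDerivAt (fun t : ℝ => t ^ 2) (2 * t) t := (hasDerivAt_pow 2 t).congr_deriv (by norm_num)
  have h := (((hasDerivAt_const t (1 + x ⬝ᵥ x)).fun_add ((hasDerivAt_id' t).const_mul (2 * (x ⬝ᵥ w)))).fun_add
    (hsq.const_mul (w ⬝ᵥ w)))
  exact h.congr_deriv (by ring)

/-- `√q(t)` has derivative `(b + ct)/√q(t)`. [folklore] -/
theorem hasDerivAt_sqrt_lineQuad (x w : Fin n → ℝ) (t : ℝ) :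
    HasDerivAt (fun t : ℝ => Real.sqrt ((1 + x ⬝ᵥ x) + 2 * (x ⬝ᵥ w) * t + (w ⬝ᵥ w) * t ^ 2))
      (((x ⬝ᵥ w) + (w ⬝ᵥ w) * t) / Real.sqrt ((1 + x ⬝ᵥ x) + 2 * (x ⬝ᵥ w) * t + (w ⬝ᵥ w) * t ^ 2)) t := by
  have hq := lineQuad_pos x w t
  have h := (hasDerivAt_lineQuad x w t).sqrt hq.ne'
  refine h.congr_deriv ?_
  rw [show 2 * (x ⬝ᵥ w) + 2 * (w ⬝ᵥ w) * t = 2 * ((x ⬝ᵥ w) + (w ⬝ᵥ w) * t) by ring,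
    mul_div_mul_left _ _ (two_ne_zero' ℝ)]

/-- **FIRST DERIVATIVE ALONG THE LINE** in closed form:
`d/dt F(x + tw) = N₁/√q − (N₀ + N₁t)(b + ct)/(q √q)`. [folklore] -/
theorem hasDerivAt_gnoProfile_line (A : ℝ) (B x w : Fin n → ℝ) (t : ℝ) :
    HasDerivAt (fun t : ℝ => gnoProfile A B (x + t • w))
      ((B ⬝ᵥ w) / Real.sqrt ((1 + x ⬝ᵥ x) + 2 * (x ⬝ᵥ w) * t + (w ⬝ᵥ w) * t ^ 2)
        - ((B ⬝ᵥ x - A) + (B ⬝ᵥ w) * t) * ((x ⬝ᵥ w) + (w ⬝ᵥ w) * t)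
          / (((1 + x ⬝ᵥ x) + 2 * (x ⬝ᵥ w) * t + (w ⬝ᵥ w) * t ^ 2)
            * Real.sqrt ((1 + x ⬝ᵥ x) + 2 * (x ⬝ᵥ w) * t + (w ⬝ᵥ w) * t ^ 2))) t := by
  have hfun : (fun t : ℝ => gnoProfile A B (x + t • w)) = fun t =>
      ((B ⬝ᵥ x - A) + (B ⬝ᵥ w) * t) / Real.sqrt ((1 + x ⬝ᵥ x) + 2 * (x ⬝ᵥ w) * t + (w ⬝ᵥ w) * t ^ 2) :=
    funext (gnoProfile_add_smul A B x w)
  rw [hfun]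
  have hq := lineQuad_pos x w t
  have hs : Real.sqrt ((1 + x ⬝ᵥ x) + 2 * (x ⬝ᵥ w) * t + (w ⬝ᵥ w) * t ^ 2) ≠ 0 := (Real.sqrt_pos.2 hq).ne'
  have hnum : HasDerivAt (fun t : ℝ => (B ⬝ᵥ x - A) + (B ⬝ᵥ w) * t) ((B ⬝ᵥ w) * 1) t :=
    ((hasDerivAt_id' t).const_mul (B ⬝ᵥ w)).const_add (B ⬝ᵥ x - A)
  have h := hnum.div (hasDerivAt_sqrt_lineQuad x w t) hs
  refine h.congr_deriv ?_
  set q : ℝ := (1 + x ⬝ᵥ x) + 2 * (x ⬝ᵥ w) * t + (w ⬝ᵥ w) * t ^ 2 with hq_def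
  have hss : Real.sqrt q ^ 2 = q := Real.sq_sqrt hq.le
  set r : ℝ := Real.sqrt q with hr_def
  rw [← hss]
  field_simp

/-- Chain rule: `d/dt F(x + tw) = DF(x + tw)(w)`. [folklore] -/
theorem hasDerivAt_gnoProfile_line_fderiv (A : ℝ) (B x w : Fin n → ℝ) (t : ℝ) :
    HasDerivAt (fun t : ℝ => gnoProfile A B (x + t • w)) (fderiv ℝ (gnoProfile A B) (x + t • w) w) t := by
  have hl : HasDerivAt (fun t : ℝ => x + t • w) w t := by
    simpa using ((hasDerivAt_id t).smul_const w).const_add x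
  have hd : Differentiable ℝ (gnoProfile A B) := (contDiff_gnoProfile A B (m := 1)).differentiable (by norm_num)
  exact (hd (x + t • w)).hasFDerivAt.comp_hasDerivAt t hl

/-- **`DF(x + tw)(w)` IN CLOSED FORM.** [folklore] -/
theorem fderiv_gnoProfile_line (A : ℝ) (B x w : Fin n → ℝ) (t : ℝ) :
    fderiv ℝ (gnoProfile A B) (x + t • w) w
      = (B ⬝ᵥ w) / Real.sqrt ((1 + x ⬝ᵥ x) + 2 * (x ⬝ᵥ w) * t + (w ⬝ᵥ w) * t ^ 2)
        - ((B ⬝ᵥ x - A) + (B ⬝ᵥ w) * t) * ((x ⬝ᵥ w) + (w ⬝ᵥ w) * t)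
          / (((1 + x ⬝ᵥ x) + 2 * (x ⬝ᵥ w) * t + (w ⬝ᵥ w) * t ^ 2)
            * Real.sqrt ((1 + x ⬝ᵥ x) + 2 * (x ⬝ᵥ w) * t + (w ⬝ᵥ w) * t ^ 2)) :=
  (hasDerivAt_gnoProfile_line_fderiv A B x w t).unique (hasDerivAt_gnoProfile_line A B x w t)

/-- **THE GRADIENT IN CLOSED FORM** (`t = 0`): `DF(x)(w) = (B·w)/√a − (B·x − A)(x·w)/(a√a)`, `a = 1 + x·x`. [folklore] -/
theorem fderiv_gnoProfile (A : ℝ) (B x w : Fin n → ℝ) :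
    fderiv ℝ (gnoProfile A B) x w
      = (B ⬝ᵥ w) / Real.sqrt (1 + x ⬝ᵥ x) - (B ⬝ᵥ x - A) * (x ⬝ᵥ w) / ((1 + x ⬝ᵥ x) * Real.sqrt (1 + x ⬝ᵥ x)) := by
  have h := fderiv_gnoProfile_line A B x w 0
  simp only [zero_smul, add_zero, mul_zero] at h
  rw [h]
  ring_nf


/-! ## §2  The Hessian of the profile in closed form -/

/-- **THE HESSIAN QUADRATIC FORM OF THE PROFILE** (closed form): with `a = 1 + x·x`,
`D²F_{A,B}(x)(w,w) = [(A − B·x)((w·w) a − 3 (x·w)²) − 2 (B·w)(x·w) a] / (a²√a)`. [folklore] -/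
def gnoHess (A : ℝ) (B x w : Fin n → ℝ) : ℝ :=
  ((A - B ⬝ᵥ x) * ((w ⬝ᵥ w) * (1 + x ⬝ᵥ x) - 3 * (x ⬝ᵥ w) ^ 2) - 2 * (B ⬝ᵥ w) * (x ⬝ᵥ w) * (1 + x ⬝ᵥ x))
    / ((1 + x ⬝ᵥ x) ^ 2 * Real.sqrt (1 + x ⬝ᵥ x))

/-- The closed form of `t ↦ DF(x + tw)(w)` has derivative `gnoHess A B x w` at `t = 0`. [folklore] -/
theorem hasDerivAt_fderiv_gnoProfile_line_zero (A : ℝ) (B x w : Fin n → ℝ) :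
    HasDerivAt (fun t : ℝ => fderiv ℝ (gnoProfile A B) (x + t • w) w) (gnoHess A B x w) 0 := by
  have hfun : (fun t : ℝ => fderiv ℝ (gnoProfile A B) (x + t • w) w) = fun t =>
      (B ⬝ᵥ w) / Real.sqrt ((1 + x ⬝ᵥ x) + 2 * (x ⬝ᵥ w) * t + (w ⬝ᵥ w) * t ^ 2)
        - ((B ⬝ᵥ x - A) + (B ⬝ᵥ w) * t) * ((x ⬝ᵥ w) + (w ⬝ᵥ w) * t)
          / (((1 + x ⬝ᵥ x) + 2 * (x ⬝ᵥ w) * t + (w ⬝ᵥ w) * t ^ 2)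
            * Real.sqrt ((1 + x ⬝ᵥ x) + 2 * (x ⬝ᵥ w) * t + (w ⬝ᵥ w) * t ^ 2)) :=
    funext (fderiv_gnoProfile_line A B x w)
  rw [hfun]
  have hq := lineQuad_pos x w 0
  have hs0 : Real.sqrt ((1 + x ⬝ᵥ x) + 2 * (x ⬝ᵥ w) * 0 + (w ⬝ᵥ w) * 0 ^ 2) ≠ 0 := (Real.sqrt_pos.2 hq).ne'
  have hqs0 : ((1 + x ⬝ᵥ x) + 2 * (x ⬝ᵥ w) * 0 + (w ⬝ᵥ w) * 0 ^ 2)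
      * Real.sqrt ((1 + x ⬝ᵥ x) + 2 * (x ⬝ᵥ w) * 0 + (w ⬝ᵥ w) * 0 ^ 2) ≠ 0 := mul_ne_zero hq.ne' hs0
  -- first summand `N₁/√q`
  have h1 := (hasDerivAt_const (0 : ℝ) (B ⬝ᵥ w)).fun_div (hasDerivAt_sqrt_lineQuad x w 0) hs0
  -- second summand `(N₀ + N₁ t)(b + c t)/(q √q)`
  have hu : HasDerivAt (fun t : ℝ => ((B ⬝ᵥ x - A) + (B ⬝ᵥ w) * t) * ((x ⬝ᵥ w) + (w ⬝ᵥ w) * t))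
      ((B ⬝ᵥ w) * 1 * ((x ⬝ᵥ w) + (w ⬝ᵥ w) * 0) + ((B ⬝ᵥ x - A) + (B ⬝ᵥ w) * 0) * ((w ⬝ᵥ w) * 1)) 0 :=
    (((hasDerivAt_id' (0 : ℝ)).const_mul (B ⬝ᵥ w)).const_add (B ⬝ᵥ x - A)).fun_mul
      (((hasDerivAt_id' (0 : ℝ)).const_mul (w ⬝ᵥ w)).const_add (x ⬝ᵥ w))
  have hv := (hasDerivAt_lineQuad x w 0).fun_mul (hasDerivAt_sqrt_lineQuad x w 0)
  have h2 := hu.fun_div hv hqs0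
  have h := h1.fun_sub h2
  refine h.congr_deriv ?_
  have h02 : (0 : ℝ) ^ 2 = 0 := by norm_num
  simp only [mul_zero, add_zero, mul_one, zero_mul, h02, zero_sub]
  unfold gnoHess
  have ha := one_add_dotProduct_self_pos x
  set a : ℝ := 1 + x ⬝ᵥ x with ha_def
  have hss : Real.sqrt a ^ 2 = a := Real.sq_sqrt ha.le
  have hr : Real.sqrt a ≠ 0 := (Real.sqrt_pos.2 ha).ne'
  set r : ℝ := Real.sqrt a with hr_def
  rw [← hss]
  field_simp
  ring

/-- **(H1) THE HESSIAN OF THE PROFILE IN CLOSED FORM**: `D²F_{A,B}(x)(w,w) = gnoHess A B x w`. [folklore] -/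
theorem fderiv_fderiv_gnoProfile (A : ℝ) (B x w : Fin n → ℝ) :
    fderiv ℝ (fderiv ℝ (gnoProfile A B)) x w w = gnoHess A B x w :=
  (hasDerivAt_fderiv_line (contDiff_gnoProfile A B) x w).unique (hasDerivAt_fderiv_gnoProfile_line_zero A B x w)

/-- At the centre the Hessian is `A·1`: `D²F_{A,B}(0)(w,w) = A |w|²` — the aligned part `A` of the datum IS the
curvature at the reference point. [folklore] -/
theorem fderiv_fderiv_gnoProfile_zero (A : ℝ) (B w : Fin n → ℝ) :
    fderiv ℝ (fderiv ℝ (gnoProfile A B)) 0 w w = A * (w ⬝ᵥ w) := by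
  rw [fderiv_fderiv_gnoProfile, gnoHess]
  simp

/-! ## §3  The window modulus `μ(A, b, ρ)` and the local Hessian bound -/

/-- **THE WINDOW MODULUS** of the profile on the Euclidean ball `x·x ≤ ρ²` for a datum with aligned part `A ≥ 0` and
transverse part `|B| ≤ b`: `μ(A, b, ρ) = A(1 − 2ρ²)/((1 + ρ²)² √(1 + ρ²)) − 3bρ` (`= A` at `ρ = 0`). [folklore] -/
def gnoMu (A b ρ : ℝ) : ℝ := A * (1 - 2 * ρ ^ 2) / ((1 + ρ ^ 2) ^ 2 * Real.sqrt (1 + ρ ^ 2)) - 3 * b * ρ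

/-- `μ(A, b, 0) = A`. [folklore] -/
theorem gnoMu_zero (A b : ℝ) : gnoMu A b 0 = A := by
  simp [gnoMu]

/-- `μ` is monotone in the aligned part `A` (on `2ρ² ≤ 1`). [folklore] -/
theorem gnoMu_mono_left {A A' b ρ : ℝ} (hAA' : A ≤ A') (hρ2 : 2 * ρ ^ 2 ≤ 1) : gnoMu A b ρ ≤ gnoMu A' b ρ := by
  unfold gnoMu
  have hD : 0 < (1 + ρ ^ 2) ^ 2 * Real.sqrt (1 + ρ ^ 2) := by positivity
  have h := div_le_div_of_nonneg_right (mul_le_mul_of_nonneg_right hAA' (by linarith : (0 : ℝ) ≤ 1 - 2 * ρ ^ 2)) hD.le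
  linarith

/-- `μ` is antitone in the transverse size `b` (on `ρ ≥ 0`). [folklore] -/
theorem gnoMu_anti_mid {A b b' ρ : ℝ} (hbb' : b ≤ b') (hρ : 0 ≤ ρ) : gnoMu A b' ρ ≤ gnoMu A b ρ := by
  unfold gnoMu
  nlinarith [mul_le_mul_of_nonneg_right hbb' hρ]

/-- Cauchy–Schwarz for the dot product: `(x·w)² ≤ (x·x)(w·w)`. [folklore] -/
theorem dotProduct_sq_le (x w : Fin n → ℝ) : (x ⬝ᵥ w) ^ 2 ≤ (x ⬝ᵥ x) * (w ⬝ᵥ w) := by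
  have h := Finset.sum_mul_sq_le_sq_mul_sq Finset.univ x w
  simpa only [dotProduct, pow_two] using h

/-- The real inequality behind the window bound (all dot products abstracted): with `a = 1 + x·x ∈ [1, 1+ρ²]`, `c = w·w`,
`β = x·w` (`β² ≤ (a−1)c`), `|N| ≤ bρ` (`N = B·x`), `|Mβ| ≤ bρc` (`M = B·w`):
`μ(A,b,ρ)·c ≤ [(A − N)(ca − 3β²) − 2Mβa]/(a²√a)`. [folklore] -/
theorem profile_ineq {A b ρ a c β N M : ℝ} (hA : 0 ≤ A) (hb : 0 ≤ b) (hρ : 0 ≤ ρ) (hρ2 : 2 * ρ ^ 2 ≤ 1) (hc : 0 ≤ c)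
    (ha1 : 1 ≤ a) (haρ : a ≤ 1 + ρ ^ 2) (hβ : β ^ 2 ≤ (a - 1) * c) (hN : |N| ≤ b * ρ) (hMβ : |M * β| ≤ b * ρ * c) :
    gnoMu A b ρ * c ≤ ((A - N) * (c * a - 3 * β ^ 2) - 2 * M * β * a) / (a ^ 2 * Real.sqrt a) := by
  -- the bracket `P = ca − 3β²`
  have hP1 : c * (1 - 2 * ρ ^ 2) ≤ c * a - 3 * β ^ 2 := by
    have h3 : 3 * β ^ 2 ≤ 3 * ((a - 1) * c) := by linarith
    have h4 : 0 ≤ c * (1 + ρ ^ 2 - a) := mul_nonneg hc (by linarith)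
    nlinarith
  have hP2 : c * a - 3 * β ^ 2 ≤ c * a := by nlinarith [sq_nonneg β]
  have hP0 : 0 ≤ c * a - 3 * β ^ 2 := (mul_nonneg hc (by linarith)).trans hP1
  have hbρ : 0 ≤ b * ρ := mul_nonneg hb hρ
  -- numerator
  have hnum : A * c * (1 - 2 * ρ ^ 2) - 3 * (b * ρ) * (c * a)
      ≤ (A - N) * (c * a - 3 * β ^ 2) - 2 * M * β * a := by
    have h1 : A * (c * (1 - 2 * ρ ^ 2)) ≤ A * (c * a - 3 * β ^ 2) := mul_le_mul_of_nonneg_left hP1 hA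
    have h2 : N * (c * a - 3 * β ^ 2) ≤ (b * ρ) * (c * a) :=
      calc N * (c * a - 3 * β ^ 2) ≤ |N| * (c * a - 3 * β ^ 2) := mul_le_mul_of_nonneg_right (le_abs_self N) hP0
        _ ≤ (b * ρ) * (c * a) := mul_le_mul hN hP2 hP0 hbρ
    have h3 : M * β * a ≤ (b * ρ * c) * a :=
      mul_le_mul_of_nonneg_right ((le_abs_self _).trans hMβ) (by linarith)
    nlinarith
  -- denominator
  have ha : 0 < a := by linarith
  have hsa1 : 1 ≤ Real.sqrt a := by rw [← Real.sqrt_one]; exact Real.sqrt_le_sqrt ha1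
  have hsaρ : Real.sqrt a ≤ Real.sqrt (1 + ρ ^ 2) := Real.sqrt_le_sqrt haρ
  have hD : 0 < a ^ 2 * Real.sqrt a := by positivity
  have hDρ : 0 < (1 + ρ ^ 2) ^ 2 * Real.sqrt (1 + ρ ^ 2) := by positivity
  have hD_le : a ^ 2 * Real.sqrt a ≤ (1 + ρ ^ 2) ^ 2 * Real.sqrt (1 + ρ ^ 2) :=
    mul_le_mul (pow_le_pow_left₀ ha.le haρ 2) hsaρ (Real.sqrt_nonneg a) (by positivity)
  have hD_ge : a ≤ a ^ 2 * Real.sqrt a := by nlinarith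
  rw [le_div_iff₀ hD, gnoMu]
  have h12 : (0 : ℝ) ≤ 1 - 2 * ρ ^ 2 := by linarith
  have hk : 0 ≤ A * (1 - 2 * ρ ^ 2) / ((1 + ρ ^ 2) ^ 2 * Real.sqrt (1 + ρ ^ 2)) :=
    div_nonneg (mul_nonneg hA h12) hDρ.le
  have hcD : c * (a ^ 2 * Real.sqrt a) ≤ c * ((1 + ρ ^ 2) ^ 2 * Real.sqrt (1 + ρ ^ 2)) :=
    mul_le_mul_of_nonneg_left hD_le hc
  have t1 := mul_le_mul_of_nonneg_left hcD hk
  have heq : A * (1 - 2 * ρ ^ 2) / ((1 + ρ ^ 2) ^ 2 * Real.sqrt (1 + ρ ^ 2))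
      * (c * ((1 + ρ ^ 2) ^ 2 * Real.sqrt (1 + ρ ^ 2))) = A * c * (1 - 2 * ρ ^ 2) := by
    field_simp
  rw [heq] at t1
  have t2 : 3 * (b * ρ) * (c * a) ≤ 3 * b * ρ * c * (a ^ 2 * Real.sqrt a) := by
    have hk2 : 0 ≤ 3 * b * ρ * c := by positivity
    nlinarith [mul_le_mul_of_nonneg_left hD_ge hk2]
  nlinarith

/-- **(H2) THE WINDOW HESSIAN BOUND OF THE PROFILE**: for `A ≥ 0`, `B·B ≤ b²`, on the ball `x·x ≤ ρ²` with `2ρ² ≤ 1`,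
`μ(A, b, ρ)·|w|² ≤ D²F_{A,B}(x)(w,w)`. [folklore] -/
theorem gnoMu_mul_le_fderiv_fderiv_gnoProfile {A b ρ : ℝ} {B x : Fin n → ℝ} (hA : 0 ≤ A) (hb : 0 ≤ b)
    (hB : B ⬝ᵥ B ≤ b ^ 2) (hρ : 0 ≤ ρ) (hρ2 : 2 * ρ ^ 2 ≤ 1) (hx : x ⬝ᵥ x ≤ ρ ^ 2) (w : Fin n → ℝ) :
    gnoMu A b ρ * (w ⬝ᵥ w) ≤ fderiv ℝ (fderiv ℝ (gnoProfile A B)) x w w := by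
  rw [fderiv_fderiv_gnoProfile, gnoHess]
  have hxx : 0 ≤ x ⬝ᵥ x := by simpa using dotProduct_star_self_nonneg x
  have hc : 0 ≤ w ⬝ᵥ w := by simpa using dotProduct_star_self_nonneg w
  have hBB : 0 ≤ B ⬝ᵥ B := by simpa using dotProduct_star_self_nonneg B
  have hβ : (x ⬝ᵥ w) ^ 2 ≤ (1 + x ⬝ᵥ x - 1) * (w ⬝ᵥ w) := by
    rw [add_sub_cancel_left]; exact dotProduct_sq_le x w
  have hN2 : (B ⬝ᵥ x) ^ 2 ≤ (b * ρ) ^ 2 :=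
    calc (B ⬝ᵥ x) ^ 2 ≤ (B ⬝ᵥ B) * (x ⬝ᵥ x) := dotProduct_sq_le B x
      _ ≤ b ^ 2 * ρ ^ 2 := mul_le_mul hB hx hxx (sq_nonneg b)
      _ = (b * ρ) ^ 2 := by ring
  have hN : |B ⬝ᵥ x| ≤ b * ρ := abs_le_of_sq_le_sq hN2 (mul_nonneg hb hρ)
  have hMβ2 : ((B ⬝ᵥ w) * (x ⬝ᵥ w)) ^ 2 ≤ (b * ρ * (w ⬝ᵥ w)) ^ 2 :=
    calc ((B ⬝ᵥ w) * (x ⬝ᵥ w)) ^ 2 = (B ⬝ᵥ w) ^ 2 * (x ⬝ᵥ w) ^ 2 := by ring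
      _ ≤ ((B ⬝ᵥ B) * (w ⬝ᵥ w)) * ((x ⬝ᵥ x) * (w ⬝ᵥ w)) :=
          mul_le_mul (dotProduct_sq_le B w) (dotProduct_sq_le x w) (sq_nonneg _) (mul_nonneg hBB hc)
      _ ≤ (b ^ 2 * (w ⬝ᵥ w)) * (ρ ^ 2 * (w ⬝ᵥ w)) :=
          mul_le_mul (mul_le_mul_of_nonneg_right hB hc) (mul_le_mul_of_nonneg_right hx hc)
            (mul_nonneg hxx hc) (mul_nonneg (sq_nonneg b) hc)
      _ = (b * ρ * (w ⬝ᵥ w)) ^ 2 := by ring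
  have hMβ : |(B ⬝ᵥ w) * (x ⬝ᵥ w)| ≤ b * ρ * (w ⬝ᵥ w) :=
    abs_le_of_sq_le_sq hMβ2 (mul_nonneg (mul_nonneg hb hρ) hc)
  have key := profile_ineq (a := 1 + x ⬝ᵥ x) (c := w ⬝ᵥ w) (β := x ⬝ᵥ w) (N := B ⬝ᵥ x) (M := B ⬝ᵥ w) hA hb hρ hρ2
    hc (by linarith) (by linarith) hβ hN hMβ
  convert key using 2

/-- The Euclidean size of the cube: `x ∈ [-S,S]ⁿ ⟹ x·x ≤ n S²`. [folklore] -/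
theorem dotProduct_self_le_of_mem_cube {S : ℝ} {x : Fin n → ℝ} (hx : x ∈ cube n S) : x ⬝ᵥ x ≤ n * S ^ 2 := by
  rw [mem_cube_iff] at hx
  calc x ⬝ᵥ x = ∑ i, x i ^ 2 := by simp [dotProduct, pow_two]
    _ ≤ ∑ _i : Fin n, S ^ 2 := Finset.sum_le_sum fun i _ => sq_le_sq' (abs_le.1 (hx i)).1 (abs_le.1 (hx i)).2
    _ = n * S ^ 2 := by simp

/-- **(H3) `HessianBoundOn` OF THE PROFILE ON THE BALL** `{x·x ≤ ρ²}` with modulus `μ(A, b, ρ)`. [folklore] -/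
theorem hessianBoundOn_gnoProfile_ball {A b ρ : ℝ} {B : Fin n → ℝ} (hA : 0 ≤ A) (hb : 0 ≤ b) (hB : B ⬝ᵥ B ≤ b ^ 2)
    (hρ : 0 ≤ ρ) (hρ2 : 2 * ρ ^ 2 ≤ 1) :
    HessianBoundOn (gnoProfile A B) {x | x ⬝ᵥ x ≤ ρ ^ 2} (gnoMu A b ρ) :=
  (hessianBoundOn_iff_fderiv (contDiff_gnoProfile A B)).2 fun _ hx w =>
    gnoMu_mul_le_fderiv_fderiv_gnoProfile hA hb hB hρ hρ2 hx w

/-- **(H3') `HessianBoundOn` OF THE PROFILE ON THE CUBE** `[-S',S']ⁿ` with modulus `μ(A, b, ρ)` whenever `n S'² ≤ ρ²`,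
`2ρ² ≤ 1` (for the one-link fibre `n = 3`: `ρ = √3·S'`, `S' ≤ 1/√6`). [folklore] -/
theorem hessianBoundOn_gnoProfile_cube {A b ρ S' : ℝ} {B : Fin n → ℝ} (hA : 0 ≤ A) (hb : 0 ≤ b) (hB : B ⬝ᵥ B ≤ b ^ 2)
    (hρ : 0 ≤ ρ) (hρ2 : 2 * ρ ^ 2 ≤ 1) (hnS : (n : ℝ) * S' ^ 2 ≤ ρ ^ 2) :
    HessianBoundOn (gnoProfile A B) (cube n S') (gnoMu A b ρ) :=
  (hessianBoundOn_gnoProfile_ball hA hb hB hρ hρ2).mono fun _ hx => (dotProduct_self_le_of_mem_cube hx).trans hnS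

/-- Adding a constant does not change a Hessian bound. [folklore] -/
theorem hessianBoundOn_const_add {f : (Fin n → ℝ) → ℝ} (C : ℝ) {K : Set (Fin n → ℝ)} {lam : ℝ}
    (h : HessianBoundOn f K lam) : HessianBoundOn (fun x => C + f x) K lam := by
  have hH : coordHessian (fun x => C + f x) = coordHessian f := by
    funext x
    simp only [coordHessian, fderiv_const_add]
  intro x hx w
  rw [hH]
  exact h x hx w

/-- Lowering the constant keeps a Hessian bound. [folklore] -/
theorem HessianBoundOn.of_le {f : (Fin n → ℝ) → ℝ} {K : Set (Fin n → ℝ)} {lam lam' : ℝ} (h : HessianBoundOn f K lam)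
    (hle : lam' ≤ lam) : HessianBoundOn f K lam' := fun x hx w =>
  (mul_le_mul_of_nonneg_right hle (by simpa using dotProduct_star_self_nonneg w)).trans (h x hx w)

/-! ### The gradient of the profile and its size on the ball (the shape of the consumer's `hgap`) -/

/-- `(X − Y)² ≤ (p + q)² c` from `X² ≤ p²c`, `Y² ≤ q²c` (square-root-free triangle inequality). [folklore] -/
theorem sq_sub_le_aux {X Y p q c : ℝ} (hp : 0 ≤ p) (hq : 0 ≤ q) (hc : 0 ≤ c) (hX : X ^ 2 ≤ p ^ 2 * c)
    (hY : Y ^ 2 ≤ q ^ 2 * c) : (X - Y) ^ 2 ≤ (p + q) ^ 2 * c := by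
  have hXY2 : (X * Y) ^ 2 ≤ (p * q * c) ^ 2 :=
    calc (X * Y) ^ 2 = X ^ 2 * Y ^ 2 := by ring
      _ ≤ (p ^ 2 * c) * (q ^ 2 * c) := mul_le_mul hX hY (sq_nonneg Y) (by positivity)
      _ = (p * q * c) ^ 2 := by ring
  have hXY : |X * Y| ≤ p * q * c := abs_le_of_sq_le_sq hXY2 (by positivity)
  have hn : -(X * Y) ≤ |X * Y| := neg_le_abs (X * Y)
  nlinarith

/-- **(G1) THE SIZE OF THE DERIVATIVE ON THE BALL**: for `B·B ≤ b²`, `x·x ≤ ρ²`,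
`(DF_{A,B}(x) w)² ≤ (b(1 + ρ²) + |A|ρ)² |w|²`. [folklore] -/
theorem sq_fderiv_gnoProfile_le {A b ρ : ℝ} {B x : Fin n → ℝ} (hb : 0 ≤ b) (hB : B ⬝ᵥ B ≤ b ^ 2) (hρ : 0 ≤ ρ)
    (hx : x ⬝ᵥ x ≤ ρ ^ 2) (w : Fin n → ℝ) :
    (fderiv ℝ (gnoProfile A B) x w) ^ 2 ≤ (b * (1 + ρ ^ 2) + |A| * ρ) ^ 2 * (w ⬝ᵥ w) := by
  rw [fderiv_gnoProfile]
  have ha := one_add_dotProduct_self_pos x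
  have hxx : 0 ≤ x ⬝ᵥ x := by simpa using dotProduct_star_self_nonneg x
  have hc : 0 ≤ w ⬝ᵥ w := by simpa using dotProduct_star_self_nonneg w
  have ha1 : 1 ≤ 1 + x ⬝ᵥ x := by linarith
  have hM2 : (B ⬝ᵥ w) ^ 2 ≤ b ^ 2 * (w ⬝ᵥ w) := (dotProduct_sq_le B w).trans (mul_le_mul_of_nonneg_right hB hc)
  have hβ2 : (x ⬝ᵥ w) ^ 2 ≤ ρ ^ 2 * (w ⬝ᵥ w) := (dotProduct_sq_le x w).trans (mul_le_mul_of_nonneg_right hx hc)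
  have hN2 : (B ⬝ᵥ x) ^ 2 ≤ (b * ρ) ^ 2 :=
    calc (B ⬝ᵥ x) ^ 2 ≤ (B ⬝ᵥ B) * (x ⬝ᵥ x) := dotProduct_sq_le B x
      _ ≤ b ^ 2 * ρ ^ 2 := mul_le_mul hB hx hxx (sq_nonneg b)
      _ = (b * ρ) ^ 2 := by ring
  have hN : |B ⬝ᵥ x| ≤ b * ρ := abs_le_of_sq_le_sq hN2 (mul_nonneg hb hρ)
  have hN₀ : |B ⬝ᵥ x - A| ≤ b * ρ + |A| := (abs_sub _ _).trans (by linarith)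
  have hN₀2 : (B ⬝ᵥ x - A) ^ 2 ≤ (b * ρ + |A|) ^ 2 :=
    calc (B ⬝ᵥ x - A) ^ 2 = |B ⬝ᵥ x - A| ^ 2 := (sq_abs _).symm
      _ ≤ (b * ρ + |A|) ^ 2 := pow_le_pow_left₀ (abs_nonneg _) hN₀ 2
  set a : ℝ := 1 + x ⬝ᵥ x with ha_def
  have hsa : Real.sqrt a ^ 2 = a := Real.sq_sqrt ha.le
  have hX : ((B ⬝ᵥ w) / Real.sqrt a) ^ 2 ≤ b ^ 2 * (w ⬝ᵥ w) := by
    rw [div_pow, hsa]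
    exact (div_le_self (sq_nonneg _) ha1).trans hM2
  have hY : ((B ⬝ᵥ x - A) * (x ⬝ᵥ w) / (a * Real.sqrt a)) ^ 2 ≤ ((b * ρ + |A|) * ρ) ^ 2 * (w ⬝ᵥ w) := by
    rw [div_pow, mul_pow, mul_pow, hsa]
    have hden : 1 ≤ a ^ 2 * a := by nlinarith
    calc (B ⬝ᵥ x - A) ^ 2 * (x ⬝ᵥ w) ^ 2 / (a ^ 2 * a) ≤ (B ⬝ᵥ x - A) ^ 2 * (x ⬝ᵥ w) ^ 2 :=
          div_le_self (by positivity) hden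
      _ ≤ (b * ρ + |A|) ^ 2 * (ρ ^ 2 * (w ⬝ᵥ w)) := mul_le_mul hN₀2 hβ2 (sq_nonneg _) (sq_nonneg _)
      _ = ((b * ρ + |A|) * ρ) ^ 2 * (w ⬝ᵥ w) := by ring
  have key := sq_sub_le_aux hb (by positivity : (0 : ℝ) ≤ (b * ρ + |A|) * ρ) hc hX hY
  calc _ ≤ (b + (b * ρ + |A|) * ρ) ^ 2 * (w ⬝ᵥ w) := key
    _ = (b * (1 + ρ ^ 2) + |A| * ρ) ^ 2 * (w ⬝ᵥ w) := by ring

/-- The coordinate vector `eᵢ` as an `if`. [folklore] -/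
theorem single_one_eq_ite (i : Fin n) : (Pi.single i (1 : ℝ) : Fin n → ℝ) = fun j => if i = j then 1 else 0 := by
  funext j
  by_cases hij : i = j
  · subst hij; simp
  · rw [Pi.single_apply, if_neg (Ne.symm hij), if_neg hij]

/-- The derivative is the dot product with the coordinate gradient: `DF(x) w = ∇F(x)·w`. [folklore] -/
theorem fderiv_apply_eq_coordGradient_dotProduct (F : (Fin n → ℝ) → ℝ) (x w : Fin n → ℝ) :
    fderiv ℝ F x w = coordGradient F x ⬝ᵥ w := by
  have h := LinearMap.pi_apply_eq_sum_univ (fderiv ℝ F x).toLinearMap w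
  rw [ContinuousLinearMap.coe_coe] at h
  rw [h, dotProduct]
  refine Finset.sum_congr rfl fun i _ => ?_
  rw [smul_eq_mul, mul_comm, coordGradient, single_one_eq_ite]

/-- From `(DF(x) w)² ≤ G²|w|²` for all `w` to `|∇F(x)|² ≤ G²` (take `w = ∇F(x)`). [folklore] -/
theorem coordGradient_sq_le_of_sq_fderiv_le {F : (Fin n → ℝ) → ℝ} {x : Fin n → ℝ} {G : ℝ}
    (h : ∀ w, (fderiv ℝ F x w) ^ 2 ≤ G ^ 2 * (w ⬝ᵥ w)) :
    coordGradient F x ⬝ᵥ coordGradient F x ≤ G ^ 2 := by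
  have hv := h (coordGradient F x)
  rw [fderiv_apply_eq_coordGradient_dotProduct] at hv
  have h0 : 0 ≤ coordGradient F x ⬝ᵥ coordGradient F x := by simpa using dotProduct_star_self_nonneg (coordGradient F x)
  nlinarith [sq_nonneg G, hv, h0]

/-- **(G2) THE SIZE OF THE GRADIENT OF THE PROFILE ON THE BALL**: `|∇F_{A,B}(x)|² ≤ (b(1 + ρ²) + |A|ρ)²` for
`B·B ≤ b²`, `x·x ≤ ρ²`. [folklore] -/
theorem coordGradient_gnoProfile_sq_le {A b ρ : ℝ} {B x : Fin n → ℝ} (hb : 0 ≤ b) (hB : B ⬝ᵥ B ≤ b ^ 2) (hρ : 0 ≤ ρ)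
    (hx : x ⬝ᵥ x ≤ ρ ^ 2) :
    coordGradient (gnoProfile A B) x ⬝ᵥ coordGradient (gnoProfile A B) x ≤ (b * (1 + ρ ^ 2) + |A| * ρ) ^ 2 :=
  coordGradient_sq_le_of_sq_fderiv_le fun w => sq_fderiv_gnoProfile_le hb hB hρ hx w

/-! ## §4  The quaternion reading: `Re(su2Quat(g·P(1,v)) · a) = −F_{Re c, Im c}(v)`, `c = a · su2Quat g` -/

/-- The imaginary part of a quaternion as a vector of `ℝ³`. [folklore] -/
def imVec (c : ℍ) : Fin 3 → ℝ := ![c.imI, c.imJ, c.imK]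

/-- `|(1, v)| = √(1 + v·v)`. [folklore] -/
theorem norm_gnomonicQuat (v : Fin 3 → ℝ) : ‖gnomonicQuat v‖ = Real.sqrt (1 + v ⬝ᵥ v) := by
  rw [← Real.sqrt_sq (norm_nonneg (gnomonicQuat v)), sq_norm_gnomonicQuat]
  congr 1
  simp [dotProduct, pow_two]

/-- `|c|² = (Re c)² + |Im c|²`. [folklore] -/
theorem imVec_dotProduct_self (c : ℍ) : imVec c ⬝ᵥ imVec c = ‖c‖ ^ 2 - c.re ^ 2 := by
  rw [sq ‖c‖, ← Quaternion.normSq_eq_norm_mul_self, Quaternion.normSq_def']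
  simp [imVec, dotProduct, Fin.sum_univ_three]
  ring

/-- `Im` is additive: `imVec (c − c') = imVec c − imVec c'`. [folklore] -/
theorem imVec_sub (c c' : ℍ) : imVec (c - c') = imVec c - imVec c' := by
  ext i
  fin_cases i <;> simp [imVec]

/-- **THE QUATERNION READING OF THE GNOMONIC POINT**: `Re(su2Quat(P(1,v)) · c) = (Re c − Im c · v)/√(1 + v·v)
= −F_{Re c, Im c}(v)`. [folklore] -/
theorem re_su2Quat_gnoPoint_mul (v : Fin 3 → ℝ) (c : ℍ) :
    (su2Quat (gnoPoint v) * c).re = -gnoProfile c.re (imVec c) v := by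
  rw [su2Quat_gnoPoint, smul_mul_assoc, Quaternion.re_smul, smul_eq_mul, norm_gnomonicQuat, gnoProfile,
    Quaternion.re_mul]
  have h0 : (gnomonicQuat v).re = 1 := rfl
  have h1 : (gnomonicQuat v).imI = v 0 := rfl
  have h2 : (gnomonicQuat v).imJ = v 1 := rfl
  have h3 : (gnomonicQuat v).imK = v 2 := rfl
  rw [h0, h1, h2, h3]
  have hd : imVec c ⬝ᵥ v = c.imI * v 0 + c.imJ * v 1 + c.imK * v 2 := by
    simp [imVec, dotProduct, Fin.sum_univ_three]
  rw [hd, neg_div', inv_mul_eq_div]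
  ring_nf

/-- **THE QUATERNION READING OF THE GNOMONIC CHART** about `g`: `Re(su2Quat(g · P(1,v)) · a) = −F_{Re c, Im c}(v)` with
`c = a · su2Quat g` (multiplicativity of `su2Quat` and `Re(pq) = Re(qp)`). [folklore] -/
theorem re_su2Quat_gnoChart_mul (g : SU2) (v : Fin 3 → ℝ) (a : ℍ) :
    (su2Quat (gnoChart g v) * a).re = -gnoProfile (a * su2Quat g).re (imVec (a * su2Quat g)) v := by
  have hcomm : ∀ p q : ℍ, (p * q).re = (q * p).re := fun p q => by simp only [Quaternion.re_mul]; ring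
  rw [gnoChart, su2Quat_mul, mul_assoc, hcomm, mul_assoc]
  exact re_su2Quat_gnoPoint_mul v (a * su2Quat g)

/-- On the cell's `SU(2)` the interface trace is the real part of the quaternion: `reTr U = Re(su2Quat U)`
(`reTr = Re Tr / 2` on the fundamental representation, `U = quatMatrix (su2Quat U)`). [folklore] -/
theorem reTr_eq_re_su2Quat (U : SU2) : reTr U = (su2Quat U).re := by
  have h : reTr U = UnitaryModel.nReTr (U : Matrix (Fin 2) (Fin 2) ℂ) := rfl
  rw [h, UnitaryModel.nReTr, ← Literature.MathematicalPhysics.QuantumLattice.quatMatrix_su2Quat U,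
    Matrix.trace_fin_two, Literature.MathematicalPhysics.QuantumLattice.quatMatrix_apply_00,
    Literature.MathematicalPhysics.QuantumLattice.quatMatrix_apply_11, Fintype.card_fin, Complex.add_re]
  simp only [Nat.cast_ofNat]
  ring

/-- Hence a conjugated one-link letter reads `reTr (L · g · R) = Re(su2Quat g · (su2Quat R · su2Quat L))` — the
quaternion-affine shape of every plaquette term through a fixed link. [folklore] -/
theorem reTr_conj_link (L g R : SU2) : reTr (L * g * R) = (su2Quat g * (su2Quat R * su2Quat L)).re := by
  rw [reTr_eq_re_su2Quat, su2Quat_mul, su2Quat_mul]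
  simp only [Quaternion.re_mul, Quaternion.imI_mul, Quaternion.imJ_mul, Quaternion.imK_mul]
  ring

/-! ## §5  One-link quaternion-affine exponents and their `C²` representatives on the gnomonic chart -/

section Link

variable {P : Params} {j : ℕ}

/-- **ONE-LINK QUATERNION-AFFINITY** of the exponent `h` at the base field `u` through the bond `b`, with datum
`(κ, a) ∈ ℝ × ℍ`: `h(u with u(b) := g) = κ + Re(su2Quat g · a)` for every `g ∈ SU(2)`.  This is the shape of every
exponent that is a sum of (conjugated) single letters `reTr(L g R)` in the link `g = U(b)` with coefficients and
cofactors not involving `U(b)` (`reTr_conj_link`) — e.g. `β Σ_p reTr U(∂p)` when the four bonds of each `∂p ∋ b` are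
distinct; NO such instance is asserted here (caveat (PLAQ)). [folklore] -/
def LinkAffine [DecidableEq (PBond P j)] (h : Density P j SU2) (u : GaugeField P j SU2) (b : PBond P j) (κ : ℝ)
    (a : ℍ) : Prop :=
  ∀ g : SU2, h (Function.update u b g) = κ + (su2Quat g * a).re

variable {b : PBond P j} {n : ℕ}

/-- Sums over the one-element type `↥{b}`. [folklore] -/
theorem sum_coe_singleton {β : Type*} [AddCommMonoid β] (G : ↥({b} : Finset (PBond P j)) → β) :
    ∑ b' : ↥({b} : Finset (PBond P j)), G b' = G ⟨b, Finset.mem_singleton_self b⟩ :=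
  Fintype.sum_eq_single _ fun b' hne => absurd (Subtype.ext (Finset.mem_singleton.1 b'.2)) hne

/-- THE LINK COORDINATES of `x ∈ ℝⁿ` along `e : {b} × Fin 3 ≃ Fin n`: `v_i = x_{e(b,i)}`. [folklore] -/
def linkCoord (e : ↥({b} : Finset (PBond P j)) × Fin 3 ≃ Fin n) (x : Fin n → ℝ) : Fin 3 → ℝ :=
  fun i => x (e (⟨b, Finset.mem_singleton_self b⟩, i))

/-- THE LINK VECTOR of a quaternion `c` on `ℝⁿ`: `(Im c)` transported along `e`. [folklore] -/
def linkVec (e : ↥({b} : Finset (PBond P j)) × Fin 3 ≃ Fin n) (c : ℍ) : Fin n → ℝ :=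
  fun k => imVec c (e.symm k).2

/-- Every `b' : ↥{b}` is `b`. [folklore] -/
theorem coe_singleton_eq (b' : ↥({b} : Finset (PBond P j))) : b' = ⟨b, Finset.mem_singleton_self b⟩ :=
  Subtype.ext (Finset.mem_singleton.1 b'.2)

/-- `linkVec e c · x = Im c · v`. [folklore] -/
theorem linkVec_dotProduct (e : ↥({b} : Finset (PBond P j)) × Fin 3 ≃ Fin n) (c : ℍ) (x : Fin n → ℝ) :
    linkVec e c ⬝ᵥ x = imVec c ⬝ᵥ linkCoord e x := by
  unfold dotProduct linkVec linkCoord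
  rw [← e.sum_comp (fun k => imVec c (e.symm k).2 * x k), Fintype.sum_prod_type, sum_coe_singleton]
  simp only [Equiv.symm_apply_apply]

/-- `x · x = v · v` (the enumeration `e` is a bijection onto the three link coordinates). [folklore] -/
theorem dotProduct_self_eq_linkCoord (e : ↥({b} : Finset (PBond P j)) × Fin 3 ≃ Fin n) (x : Fin n → ℝ) :
    x ⬝ᵥ x = linkCoord e x ⬝ᵥ linkCoord e x := by
  unfold dotProduct linkCoord
  rw [← e.sum_comp (fun k => x k * x k), Fintype.sum_prod_type, sum_coe_singleton]

/-- `linkVec e c · linkVec e c = |Im c|²`. [folklore] -/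
theorem linkVec_dotProduct_self (e : ↥({b} : Finset (PBond P j)) × Fin 3 ≃ Fin n) (c : ℍ) :
    linkVec e c ⬝ᵥ linkVec e c = ‖c‖ ^ 2 - c.re ^ 2 := by
  rw [← imVec_dotProduct_self]
  unfold dotProduct linkVec
  rw [← e.sum_comp (fun k => imVec c (e.symm k).2 * imVec c (e.symm k).2), Fintype.sum_prod_type, sum_coe_singleton]
  simp only [Equiv.symm_apply_apply]

/-- `linkVec` is additive. [folklore] -/
theorem linkVec_sub (e : ↥({b} : Finset (PBond P j)) × Fin 3 ≃ Fin n) (c c' : ℍ) :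
    linkVec e c - linkVec e c' = linkVec e (c - c') := by
  funext k
  simp [linkVec, imVec_sub]

/-- The profile of the transported datum is the profile in link coordinates. [folklore] -/
theorem gnoProfile_linkVec (e : ↥({b} : Finset (PBond P j)) × Fin 3 ≃ Fin n) (A : ℝ) (c : ℍ) (x : Fin n → ℝ) :
    gnoProfile A (linkVec e c) x = gnoProfile A (imVec c) (linkCoord e x) := by
  rw [gnoProfile, gnoProfile, linkVec_dotProduct, dotProduct_self_eq_linkCoord e x]

/-- The gnomonic fibre chart through `{b}` at the link `b` is the gnomonic chart in link coordinates. [folklore] -/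
theorem gnoFibreChart_singleton (u₀ : GaugeField P j SU2) (e : ↥({b} : Finset (PBond P j)) × Fin 3 ≃ Fin n)
    (x : Fin n → ℝ) :
    gnoFibreChart {b} u₀ e x ⟨b, Finset.mem_singleton_self b⟩ = gnoChart (u₀ b) (linkCoord e x) := rfl

/-- **THE `C²` REPRESENTATIVE ON `ℝⁿ`** of the pulled-back action `x ↦ −h(u ←_b u₀(b)·P(1, v(x)))` of a one-link
quaternion-affine exponent with datum `(κ, a)`, chart about `u₀`: `g(x) = −κ + F_{Re c, linkVec c}(x)`,
`c = a · su2Quat (u₀ b)`. [folklore] -/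
def linkRep (e : ↥({b} : Finset (PBond P j)) × Fin 3 ≃ Fin n) (u₀ : GaugeField P j SU2) (κ : ℝ) (a : ℍ) :
    (Fin n → ℝ) → ℝ :=
  fun x => -κ + gnoProfile (a * su2Quat (u₀ b)).re (linkVec e (a * su2Quat (u₀ b))) x

variable {u₀ u : GaugeField P j SU2} {h : Density P j SU2} {κ : ℝ} {a : ℍ}

/-- **(R1) AGREEMENT ON ALL OF `ℝⁿ`**: `linkRep e u₀ κ a x = −h(u ←_{{b}} φ_{u₀,e}(x))` for a one-link affine `h` at `u`
through `b` (the consumer's `agree₀`/`agree₁`, even without the restriction to the cube). [folklore] -/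
theorem linkRep_eq [DecidableEq (PBond P j)] (e : ↥({b} : Finset (PBond P j)) × Fin 3 ≃ Fin n)
    (haff : LinkAffine h u b κ a) (x : Fin n → ℝ) :
    linkRep e u₀ κ a x = -h (updateFinset u {b} (gnoFibreChart {b} u₀ e x)) := by
  rw [Function.updateFinset_singleton, gnoFibreChart_singleton, haff, re_su2Quat_gnoChart_mul, linkRep,
    gnoProfile_linkVec]
  ring

/-- **(R2)** the representative is smooth. [folklore] -/
theorem contDiff_linkRep (e : ↥({b} : Finset (PBond P j)) × Fin 3 ≃ Fin n) (u₀ : GaugeField P j SU2) (κ : ℝ)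
    (a : ℍ) {m : WithTop ℕ∞} : ContDiff ℝ m (linkRep e u₀ κ a) :=
  contDiff_const.add (contDiff_gnoProfile _ _)

/-- **(R3) THE LOCAL HESSIAN BOUND OF THE REPRESENTATIVE** on the cube `[-S',S']ⁿ`: with `c = a · su2Quat(u₀ b)`,
aligned part `A = Re c ≥ 0`, transverse part `|Im c|² = |a|² − (Re c)² ≤ b₀²`, and `n S'² ≤ ρ²`, `2ρ² ≤ 1`:
`Hess (linkRep) ≥ μ(Re c, b₀, ρ)` on `[-S',S']ⁿ`. [folklore] -/
theorem hessianBoundOn_linkRep (e : ↥({b} : Finset (PBond P j)) × Fin 3 ≃ Fin n) (κ : ℝ) {b₀ ρ S' : ℝ}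
    (hA : 0 ≤ (a * su2Quat (u₀ b)).re) (hb₀ : 0 ≤ b₀) (hB : ‖a‖ ^ 2 - (a * su2Quat (u₀ b)).re ^ 2 ≤ b₀ ^ 2)
    (hρ : 0 ≤ ρ) (hρ2 : 2 * ρ ^ 2 ≤ 1) (hnS : (n : ℝ) * S' ^ 2 ≤ ρ ^ 2) :
    HessianBoundOn (linkRep e u₀ κ a) (cube n S') (gnoMu (a * su2Quat (u₀ b)).re b₀ ρ) := by
  have hB' : linkVec e (a * su2Quat (u₀ b)) ⬝ᵥ linkVec e (a * su2Quat (u₀ b)) ≤ b₀ ^ 2 := by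
    rw [linkVec_dotProduct_self, norm_mul, Literature.MathematicalPhysics.QuantumLattice.norm_su2Quat, mul_one]
    exact hB
  exact hessianBoundOn_const_add (-κ) (hessianBoundOn_gnoProfile_cube hA hb₀ hB' hρ hρ2 hnS)

/-- The difference of two representatives (same chart centre `u₀`, data `(κ₀,a₀)`, `(κ₁,a₁)`) is a constant plus the
profile of the DIFFERENCE datum `(a₁ − a₀) · su2Quat(u₀ b)` — the entrance of the consumer's gradient-gap binder `hgap`.
[folklore] -/
theorem linkRep_sub (e : ↥({b} : Finset (PBond P j)) × Fin 3 ≃ Fin n) (u₀ : GaugeField P j SU2) (κ₀ κ₁ : ℝ)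
    (a₀ a₁ : ℍ) (x : Fin n → ℝ) :
    linkRep e u₀ κ₁ a₁ x - linkRep e u₀ κ₀ a₀ x
      = (κ₀ - κ₁) + gnoProfile ((a₁ - a₀) * su2Quat (u₀ b)).re (linkVec e ((a₁ - a₀) * su2Quat (u₀ b))) x := by
  rw [linkRep, linkRep, sub_mul, Quaternion.re_sub, ← linkVec_sub, ← gnoProfile_sub]
  ring

/-- **(R4) THE GRADIENT GAP OF TWO REPRESENTATIVES** (same chart centre `u₀`; data `(κ₀,a₀)`, `(κ₁,a₁)`) on the ball
`x·x ≤ ρ²`: `|∇(g₁ − g₀)(x)|² ≤ (|a₁ − a₀|·(1 + ρ + ρ²))²` — the consumer's `hgap` holds with `b_H·dev u` any number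
`≥ |a₁ − a₀|(1 + ρ + ρ²)`. [folklore] -/
theorem coordGradient_linkRep_sub_sq_le (e : ↥({b} : Finset (PBond P j)) × Fin 3 ≃ Fin n) (u₀ : GaugeField P j SU2)
    (κ₀ κ₁ : ℝ) (a₀ a₁ : ℍ) {ρ : ℝ} (hρ : 0 ≤ ρ) {x : Fin n → ℝ} (hx : x ⬝ᵥ x ≤ ρ ^ 2) :
    coordGradient (fun x => linkRep e u₀ κ₁ a₁ x - linkRep e u₀ κ₀ a₀ x) x
        ⬝ᵥ coordGradient (fun x => linkRep e u₀ κ₁ a₁ x - linkRep e u₀ κ₀ a₀ x) x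
      ≤ (‖a₁ - a₀‖ * (1 + ρ + ρ ^ 2)) ^ 2 := by
  have hfun : (fun x => linkRep e u₀ κ₁ a₁ x - linkRep e u₀ κ₀ a₀ x) = fun x => (κ₀ - κ₁)
      + gnoProfile ((a₁ - a₀) * su2Quat (u₀ b)).re (linkVec e ((a₁ - a₀) * su2Quat (u₀ b))) x :=
    funext (linkRep_sub e u₀ κ₀ κ₁ a₀ a₁)
  have hgrad : coordGradient (fun x => linkRep e u₀ κ₁ a₁ x - linkRep e u₀ κ₀ a₀ x) x
      = coordGradient (gnoProfile ((a₁ - a₀) * su2Quat (u₀ b)).re (linkVec e ((a₁ - a₀) * su2Quat (u₀ b)))) x := by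
    rw [hfun]
    funext i
    simp only [coordGradient, fderiv_const_add]
  rw [hgrad]
  have hnorm : ‖(a₁ - a₀) * su2Quat (u₀ b)‖ = ‖a₁ - a₀‖ := by
    rw [norm_mul, Literature.MathematicalPhysics.QuantumLattice.norm_su2Quat, mul_one]
  have hB : linkVec e ((a₁ - a₀) * su2Quat (u₀ b)) ⬝ᵥ linkVec e ((a₁ - a₀) * su2Quat (u₀ b)) ≤ ‖a₁ - a₀‖ ^ 2 := by
    rw [linkVec_dotProduct_self, hnorm]
    linarith [sq_nonneg ((a₁ - a₀) * su2Quat (u₀ b)).re]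
  have hA : |((a₁ - a₀) * su2Quat (u₀ b)).re| ≤ ‖a₁ - a₀‖ := by
    rw [← hnorm]
    refine abs_le_of_sq_le_sq ?_ (norm_nonneg _)
    have h1 := imVec_dotProduct_self ((a₁ - a₀) * su2Quat (u₀ b))
    have h2 : (0 : ℝ) ≤ imVec ((a₁ - a₀) * su2Quat (u₀ b)) ⬝ᵥ imVec ((a₁ - a₀) * su2Quat (u₀ b)) := by
      simpa using dotProduct_star_self_nonneg (imVec ((a₁ - a₀) * su2Quat (u₀ b)))
    linarith
  have h0 : 0 ≤ ‖a₁ - a₀‖ := norm_nonneg _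
  refine (coordGradient_gnoProfile_sq_le h0 hB hρ hx).trans ?_
  have h1 : ‖a₁ - a₀‖ * (1 + ρ ^ 2) + |((a₁ - a₀) * su2Quat (u₀ b)).re| * ρ ≤ ‖a₁ - a₀‖ * (1 + ρ + ρ ^ 2) := by
    nlinarith [mul_le_mul_of_nonneg_right hA hρ]
  exact pow_le_pow_left₀ (by positivity) h1 2

end Link

/-! ## §6  THE PLUG: `mem_respDom_of_gnoChart_local` on the one-link fibre with the action binders DISCHARGED -/

section Plug

variable {P : Params} {j : ℕ} [DecidableEq (PBond P j)] {b : PBond P j} {n : ℕ} {u₀ : GaugeField P j SU2} {S : ℝ}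

open T4CovarianceResponse (respDom)

/-- **THE ONE-LINK GNOMONIC PLUG WITH THE ACTION HALF OF THE MODULUS DISCHARGED.**
`T4CubeConvexExtension.mem_respDom_of_gnoChart_local` on the fibre `s = {b}` for an exponent `h` that is one-link
quaternion-affine through `b` at `u₀` (datum `(κ₀,a₀)`) and at `u` (datum `(κ₁,a₁)`): its binders `hg₀ hg₁ hB₀ hB₁ agree₀
agree₁` are supplied by the representatives `linkRep` (R1)–(R3); what is asked instead is NUMERIC — aligned parts
`Re(aᵢ·su2Quat(u₀ b)) ≥ 0`, transverse parts `|aᵢ|² − Re(aᵢ·su2Quat(u₀ b))² ≤ b₀²`, a ball radius `ρ` with `n S'² ≤ ρ²`,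
`2ρ² ≤ 1`, and a modulus `μ ≤ μ(Re(aᵢ q₀), b₀, ρ)` with `κ(S') + μ > 0`.  The gradient-gap binder `hgap` (the (REAL) /
Lipschitz input, Bałaban-side) and the insert binders are untouched (see `linkRep_sub`, `fderiv_gnoProfile` for the
shape `hgap` takes). [folklore] -/
theorem mem_respDom_of_gnoChart_linkAffine {β : Type*} (e : ↥({b} : Finset (PBond P j)) × Fin 3 ≃ Fin n) (hS : 0 < S)
    {S' : ℝ} (hSS' : S < S') (hS'1 : S' ≤ 1) {h : Density P j SU2} (hhm : Measurable h) {C : ℝ}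
    (hC : ∀ U, windowDensity {b} u₀ S U * Real.exp (h U) ≤ C) {u : GaugeField P j SU2} {K : ℝ}
    (hK : ∀ y : ↥({b} : Finset (PBond P j)) → SU2, |h (updateFinset u₀ {b} y) - h (updateFinset u {b} y)| ≤ K)
    {dev : GaugeField P j SU2 → ℝ} (hdev : 0 ≤ dev u) {κ₀ κ₁ : ℝ} {a₀ a₁ : ℍ} (haff₀ : LinkAffine h u₀ b κ₀ a₀)
    (haff₁ : LinkAffine h u b κ₁ a₁) (hA₀ : 0 ≤ (a₀ * su2Quat (u₀ b)).re) (hA₁ : 0 ≤ (a₁ * su2Quat (u₀ b)).re)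
    {b₀ : ℝ} (hb₀ : 0 ≤ b₀) (hB₀ : ‖a₀‖ ^ 2 - (a₀ * su2Quat (u₀ b)).re ^ 2 ≤ b₀ ^ 2)
    (hB₁ : ‖a₁‖ ^ 2 - (a₁ * su2Quat (u₀ b)).re ^ 2 ≤ b₀ ^ 2) {ρ : ℝ} (hρ : 0 ≤ ρ) (hρ2 : 2 * ρ ^ 2 ≤ 1)
    (hnS : (n : ℝ) * S' ^ 2 ≤ ρ ^ 2) {mu : ℝ} (hmu₀ : mu ≤ gnoMu (a₀ * su2Quat (u₀ b)).re b₀ ρ)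
    (hmu₁ : mu ≤ gnoMu (a₁ * su2Quat (u₀ b)).re b₀ ρ) (hlam : 0 < gnoKappa S' + mu) {bH : ℝ}
    (hgap : ∀ x ∈ cube n S,
      coordGradient (fun x => linkRep e u₀ κ₁ a₁ x - linkRep e u₀ κ₀ a₀ x) x
        ⬝ᵥ coordGradient (fun x => linkRep e u₀ κ₁ a₁ x - linkRep e u₀ κ₀ a₀ x) x ≤ (bH * dev u) ^ 2)
    {B : (↥({b} : Finset (PBond P j)) → SU2) → β → ℝ} {T : Finset β} (hBm : ∀ i ∈ T, Measurable fun y => B y i)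
    {L : ℝ}
    (hBg : ∀ i ∈ T, ∃ g : (Fin n → ℝ) → ℝ, ContDiff ℝ 1 g ∧
      (∀ x ∈ cube n S, g x = B (gnoFibreChart {b} u₀ e x) i) ∧
      ∀ x ∈ cube n S, coordGradient g x ⬝ᵥ coordGradient g x ≤ L ^ 2) :
    u ∈ respDom {b} (windowDensity {b} u₀ S) h u₀ B T dev (bH / Real.sqrt (gnoKappa S' + mu))
      (L / Real.sqrt (gnoKappa S' + mu)) :=
  mem_respDom_of_gnoChart_local e hS hSS' hS'1 hhm hC hK hdev hlam (contDiff_linkRep e u₀ κ₀ a₀)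
    (contDiff_linkRep e u₀ κ₁ a₁) (HessianBoundOn.of_le (hessianBoundOn_linkRep e κ₀ hA₀ hb₀ hB₀ hρ hρ2 hnS) hmu₀)
    (HessianBoundOn.of_le (hessianBoundOn_linkRep e κ₁ hA₁ hb₀ hB₁ hρ hρ2 hnS) hmu₁) (fun x _ => linkRep_eq e haff₀ x)
    (fun x _ => linkRep_eq e haff₁ x) hgap hBm hBg

/-- **THE SAME PLUG WITH THE GRADIENT GAP DISCHARGED TOO** (R4): the binder `hgap` is replaced by the single number
`|a₁ − a₀|(1 + ρ + ρ²) ≤ b_H · dev u` — for data `aᵢ` built from the cofactors of the link in `h` (staples), `|a₁ − a₀|`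
is the natural deviation of `u` from `u₀` near `b`, and `b_H` its coefficient; nothing Bałaban-side is sized here.
[folklore] -/
theorem mem_respDom_of_gnoChart_linkAffine' {β : Type*} (e : ↥({b} : Finset (PBond P j)) × Fin 3 ≃ Fin n) (hS : 0 < S)
    {S' : ℝ} (hSS' : S < S') (hS'1 : S' ≤ 1) {h : Density P j SU2} (hhm : Measurable h) {C : ℝ}
    (hC : ∀ U, windowDensity {b} u₀ S U * Real.exp (h U) ≤ C) {u : GaugeField P j SU2} {K : ℝ}
    (hK : ∀ y : ↥({b} : Finset (PBond P j)) → SU2, |h (updateFinset u₀ {b} y) - h (updateFinset u {b} y)| ≤ K)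
    {dev : GaugeField P j SU2 → ℝ} (hdev : 0 ≤ dev u) {κ₀ κ₁ : ℝ} {a₀ a₁ : ℍ} (haff₀ : LinkAffine h u₀ b κ₀ a₀)
    (haff₁ : LinkAffine h u b κ₁ a₁) (hA₀ : 0 ≤ (a₀ * su2Quat (u₀ b)).re) (hA₁ : 0 ≤ (a₁ * su2Quat (u₀ b)).re)
    {b₀ : ℝ} (hb₀ : 0 ≤ b₀) (hB₀ : ‖a₀‖ ^ 2 - (a₀ * su2Quat (u₀ b)).re ^ 2 ≤ b₀ ^ 2)
    (hB₁ : ‖a₁‖ ^ 2 - (a₁ * su2Quat (u₀ b)).re ^ 2 ≤ b₀ ^ 2) {ρ : ℝ} (hρ : 0 ≤ ρ) (hρ2 : 2 * ρ ^ 2 ≤ 1)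
    (hnS : (n : ℝ) * S' ^ 2 ≤ ρ ^ 2) {mu : ℝ} (hmu₀ : mu ≤ gnoMu (a₀ * su2Quat (u₀ b)).re b₀ ρ)
    (hmu₁ : mu ≤ gnoMu (a₁ * su2Quat (u₀ b)).re b₀ ρ) (hlam : 0 < gnoKappa S' + mu) {bH : ℝ}
    (hgapN : ‖a₁ - a₀‖ * (1 + ρ + ρ ^ 2) ≤ bH * dev u)
    {B : (↥({b} : Finset (PBond P j)) → SU2) → β → ℝ} {T : Finset β} (hBm : ∀ i ∈ T, Measurable fun y => B y i)
    {L : ℝ}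
    (hBg : ∀ i ∈ T, ∃ g : (Fin n → ℝ) → ℝ, ContDiff ℝ 1 g ∧
      (∀ x ∈ cube n S, g x = B (gnoFibreChart {b} u₀ e x) i) ∧
      ∀ x ∈ cube n S, coordGradient g x ⬝ᵥ coordGradient g x ≤ L ^ 2) :
    u ∈ respDom {b} (windowDensity {b} u₀ S) h u₀ B T dev (bH / Real.sqrt (gnoKappa S' + mu))
      (L / Real.sqrt (gnoKappa S' + mu)) := by
  refine mem_respDom_of_gnoChart_linkAffine e hS hSS' hS'1 hhm hC hK hdev haff₀ haff₁ hA₀ hA₁ hb₀ hB₀ hB₁ hρ hρ2 hnS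
    hmu₀ hmu₁ hlam (fun x hx => ?_) hBm hBg
  have hSS : cube n S ⊆ cube n S' := cube_subset_cube hSS'.le
  have hx' : x ⬝ᵥ x ≤ ρ ^ 2 := (dotProduct_self_le_of_mem_cube (hSS hx)).trans hnS
  refine (coordGradient_linkRep_sub_sq_le e u₀ κ₀ κ₁ a₀ a₁ hρ hx').trans ?_
  exact pow_le_pow_left₀ (by positivity) hgapN 2

/-- NON-VACUITY of the numeric side at the centre of a small window: for an ALIGNED datum (`Re(a q₀) = A > 0`, no
transverse part) and `ρ = 0` the modulus is `μ = A` and `κ(0) + A = 4 + A > 0`. [folklore] -/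
example {A : ℝ} (hA : 0 < A) : 0 < gnoKappa 0 + gnoMu A 0 0 := by
  rw [gnoKappa_zero, gnoMu_zero]; linarith

end Plug

end Literature.MathematicalPhysics.QuantumFieldTheory.Balaban1983to89.T4GnomonicWilsonHessian

end
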